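import Summits.ABC.ABC.Theorems.CongruentialReceptacleTameLocalReceptacleFamilyCounts

/-!
# Crux `TameLocalReceptacle` (stmt-ABC-14354), line `grh-friable-cell-resolution`:
# valuation cells of the explicit families inside crude ternary boxes

Helper file of the registered stub `stub_tailCells : FamilySize → TailCells` of the checked skeleton
`Cruxes/TameLocalReceptacle/Lines/grh_friable_cell_resolution.lean` (lead `prover-line-stmt-ABC-14354-a1-0`,
wave 6 "tails"; registered helper stub `stub_tailPairs`).  By `…FamilyCounts.lean`, `#F · cellMass F P q v` is the
number of parameter pairs of the family whose member in position `P` has `q`-valuation exactly `v`.  Dividing that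
member by `q^v` injects these pairs into the `y`-friable solutions `(n₁, n₂, n₃)` of a ternary equation
`d₁n₁ + σd₂n₂ = n₃` in BOXES, one of them shrunken by `q^v` — the sets counted by the tree's
`Literature…ternary_crude_count_two_regimes` (filter of `S(z₁,y) × S(z₂,y) × S(z₃,y)`,
`S(z, y) = Nat.smoothNumbersUpTo z (y+1)`, by `(d₁ t.1 : ℤ) + σ (d₂ t.2.1) = t.2.2`):
* `FAfam N M y` (pairs `(m, b)`, `X = 2^N M`): position `A` (`q^v ∥ 2^N m`, `q` odd ⇒ `q^v ∣ m`):
  `(m/q^v, b, 2^N m + b)`, `2^N q^v · n₁ + n₂ = n₃`, boxes `(2M/q^v, 2X, 4X)`; position `B`: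
  `(b/q^v, m, c)`, `q^v n₁ + 2^N n₂ = n₃`, boxes `(2X/q^v, 2M, 4X)`; position `C`: `(c/q^v, m, b)`,
  `q^v n₁ − 2^N n₂ = n₃`, boxes `(4X/q^v, 2M, 2X)` (`tailPairsA_A/B/C`; `stub_tailPairs` = `tailPairsA_A` verbatim);
* `FCfam N M y` (pairs `(m, a)`, `c = 2^N m`, `b = c − a`): position `A`: `(m, a/q^v, b)`, `2^N n₁ − q^v n₂ = n₃`,
  boxes `(4M, 2X/q^v, 4X)`; position `B`: `(m, b/q^v, a)`, boxes `(4M, 4X/q^v, 2X)`; position `C` (`q^v ∣ m`):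
  `(m/q^v, a, b)`, `2^N q^v n₁ − n₂ = n₃`, boxes `(4M/q^v, 2X, 4X)` (`tailPairsC_A/B/C`).
Injectivity never needs the division: two of the three coordinates are original parameters/members.
-/

-- `Summit.<Summit>.<Problem>` is the mandated summit-side namespace (CONVENTIONS §2); for the
-- single-conjunct summit `ABC` the two coincide, so the duplicate `ABC.ABC` is deliberate.
set_option linter.dupNamespace false

noncomputable section

namespace Summit.ABC.ABC.Theorems.TameLocalReceptacle

open Finset FamilyCountsBook

namespace TailPairsBook

/-! ### Small arithmetic helpers -/

/-- For `q ≠ 2`, `v_q(2^N m) = v_q(m)`. [folklore] -/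
theorem factorization_two_pow_mul {q : ℕ} (hq2 : q ≠ 2) (N m : ℕ) :
    (2 ^ N * m).factorization q = m.factorization q := by
  rcases eq_or_ne m 0 with rfl | hm
  · simp
  rw [Nat.factorization_mul (pow_ne_zero N two_ne_zero) hm, Finsupp.add_apply,
    Nat.Prime.factorization_pow Nat.prime_two, Finsupp.single_apply, if_neg (Ne.symm hq2), zero_add]

/-- `v_q(n) = v` gives `q^v ∣ n`. [folklore] -/
theorem pow_dvd_of_factorization_eq {n q v : ℕ} (h : n.factorization q = v) : q ^ v ∣ n :=
  h ▸ Nat.ordProj_dvd n q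

/-- A `k`-smooth `n ≤ B` divisible by `d` gives the `k`-smooth `n/d ≤ B/d`. [folklore] -/
theorem div_mem_smoothNumbersUpTo {n k B d : ℕ} (hn : n ∈ Nat.smoothNumbers k) (hnB : n ≤ B) (hd : d ∣ n) :
    n / d ∈ Nat.smoothNumbersUpTo (B / d) k :=
  Nat.mem_smoothNumbersUpTo.2 ⟨Nat.div_le_div_right hnB, Nat.mem_smoothNumbers_of_dvd hn (Nat.div_dvd_of_dvd hd)⟩

/-- A `k`-smooth `n ≤ B` is in `S(B, k)`. [folklore] -/
theorem mem_smoothNumbersUpTo_of_le {n k B : ℕ} (hn : n ∈ Nat.smoothNumbers k) (hnB : n ≤ B) :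
    n ∈ Nat.smoothNumbersUpTo B k :=
  Nat.mem_smoothNumbersUpTo.2 ⟨hnB, hn⟩

/-! ### The parameter pairs of `FA` and `FC` unpacked -/

/-- A parameter pair `(m, b)` of `FAfam N M y`. [folklore] -/
theorem mem_pairsA {N M y : ℕ} {p : ℕ × ℕ}
    (hp : p ∈ (((friableIoc y M (2 * M)).filter (fun m => Odd m)) ×ˢ friableIoc y (2 ^ N * M) (2 * (2 ^ N * M))).filter
      (fun p => Nat.Coprime p.2 (2 * p.1) ∧ 2 ^ N * p.1 + p.2 ∈ Nat.smoothNumbers (y + 1))) :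
    p.1 ≤ 2 * M ∧ p.1 ∈ Nat.smoothNumbers (y + 1) ∧ p.2 ≤ 2 * (2 ^ N * M) ∧
      p.2 ∈ Nat.smoothNumbers (y + 1) ∧ 2 ^ N * p.1 + p.2 ∈ Nat.smoothNumbers (y + 1) := by
  simp only [friableIoc, Finset.mem_filter, Finset.mem_product, Finset.mem_Ioc] at hp
  exact ⟨hp.1.1.1.1.2, hp.1.1.1.2, hp.1.2.1.2, hp.1.2.2, hp.2.2⟩

/-- A parameter pair `(m, a)` of `FCfam N M y`: boxes, friability, and `a + b = 2^N m`. [folklore] -/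
theorem mem_pairsC {N M y : ℕ} {p : ℕ × ℕ}
    (hp : p ∈ (((friableIoc y (2 * M) (4 * M)).filter (fun m => Odd m)) ×ˢ friableIoc y (2 ^ N * M) (3 * (2 ^ N * M) / 2)).filter
      (fun p => Nat.Coprime p.2 (2 * p.1) ∧ 2 ^ N * p.1 - p.2 ∈ Nat.smoothNumbers (y + 1))) :
    p.1 ≤ 4 * M ∧ p.1 ∈ Nat.smoothNumbers (y + 1) ∧ p.2 ≤ 2 * (2 ^ N * M) ∧
      p.2 ∈ Nat.smoothNumbers (y + 1) ∧ 2 ^ N * p.1 - p.2 ∈ Nat.smoothNumbers (y + 1) ∧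
      2 ^ N * p.1 - p.2 ≤ 4 * (2 ^ N * M) ∧ p.2 + (2 ^ N * p.1 - p.2) = 2 ^ N * p.1 := by
  have hsum := (abc_of_mem_pairsC hp).2
  simp only [friableIoc, Finset.mem_filter, Finset.mem_product, Finset.mem_Ioc] at hp
  obtain ⟨⟨⟨⟨-, hm4⟩, hms⟩, -⟩, ⟨-, ha3⟩, has⟩ := hp.1
  refine ⟨hm4, hms, by omega, has, hp.2.2, ?_, hsum⟩
  calc 2 ^ N * p.1 - p.2 ≤ 2 ^ N * p.1 := Nat.sub_le _ _
    _ ≤ 2 ^ N * (4 * M) := Nat.mul_le_mul_left _ hm4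
    _ = 4 * (2 ^ N * M) := by ring

end TailPairsBook

open TailPairsBook

/-! ### The family `FA` -/

/-- Position `A` of `FA`: `#FA · cellMass FA A q v` is at most the number of friable `(n₁, n₂, n₃)`,
`n₁ ≤ 2M/q^v`, `n₂ ≤ 2X`, `n₃ ≤ 4X`, with `2^N q^v n₁ + n₂ = n₃` (`(m, b) ↦ (m/q^v, b, 2^N m + b)`). [folklore] -/
theorem tailPairsA_A {q v : ℕ} (hq : q.Prime) (hq2 : q ≠ 2) (hv : 1 ≤ v) (N M y : ℕ) :
    ((FAfam N M y).card : ℝ) * cellMass (FAfam N M y) Pos.A q v ≤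
      (#((Nat.smoothNumbersUpTo (2 * M / q ^ v) (y + 1) ×ˢ Nat.smoothNumbersUpTo (2 * (2 ^ N * M)) (y + 1) ×ˢ
            Nat.smoothNumbersUpTo (4 * (2 ^ N * M)) (y + 1)).filter
          (fun t : ℕ × ℕ × ℕ => ((2 ^ N * q ^ v : ℕ) : ℤ) * (t.1 : ℤ) + (1 : ℤ) * (((1 : ℕ) : ℤ) * (t.2.1 : ℤ)) =
            (t.2.2 : ℤ))) : ℝ) := by
  rw [familyCellA_A hq hv]
  refine Nat.cast_le.2 (Finset.card_le_card_of_injOn (fun p : ℕ × ℕ => (p.1 / q ^ v, p.2, 2 ^ N * p.1 + p.2))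
    (fun p hp => ?_) (fun p hp p' hp' h => ?_))
  · rw [Finset.coe_filter] at hp
    obtain ⟨hpP, hfac⟩ := hp
    obtain ⟨hm2, hms, hb2, hbs, hcs⟩ := mem_pairsA hpP
    rw [factorization_two_pow_mul hq2] at hfac
    have hdvd : q ^ v ∣ p.1 := pow_dvd_of_factorization_eq hfac
    have e : 2 ^ N * q ^ v * (p.1 / q ^ v) = 2 ^ N * p.1 := by rw [mul_assoc, Nat.mul_div_cancel' hdvd]
    refine Finset.mem_coe.2 (Finset.mem_filter.2 ⟨Finset.mem_product.2 ⟨div_mem_smoothNumbersUpTo hms hm2 hdvd,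
      Finset.mem_product.2 ⟨mem_smoothNumbersUpTo_of_le hbs hb2, mem_smoothNumbersUpTo_of_le hcs ?_⟩⟩, ?_⟩)
    · calc 2 ^ N * p.1 + p.2 ≤ 2 ^ N * (2 * M) + 2 * (2 ^ N * M) := Nat.add_le_add (Nat.mul_le_mul_left _ hm2) hb2
        _ = 4 * (2 ^ N * M) := by ring
    · dsimp only
      rw [one_mul, Nat.cast_one, one_mul, ← Nat.cast_mul, e, Nat.cast_add]
  · simp only [Prod.mk.injEq] at h
    obtain ⟨-, h2, h3⟩ := h
    rw [h2] at h3
    exact Prod.ext (Nat.eq_of_mul_eq_mul_left (Nat.two_pow_pos N) (Nat.add_right_cancel h3)) h2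

/-- **Registered helper stub `stub_tailPairs`** (wave 6 "tails", line `grh-friable-cell-resolution` of crux
stmt-ABC-14354): `tailPairsA_A` verbatim — the position-`A` valuation cell of `FAfam N M y` at `(q, v)` injects into the
friable solutions of `2^N q^v n₁ + n₂ = n₃` in the boxes `(2M/q^v, 2X, 4X)`. [folklore] -/
theorem stub_tailPairs : ∀ (N M y q v : ℕ), q.Prime → q ≠ 2 → 1 ≤ v → ((FAfam N M y).card : ℝ) * cellMass (FAfam N M y) Pos.A q v ≤ (#((Nat.smoothNumbersUpTo (2 * M / q ^ v) (y + 1) ×ˢ Nat.smoothNumbersUpTo (2 * (2 ^ N * M)) (y + 1) ×ˢ Nat.smoothNumbersUpTo (4 * (2 ^ N * M)) (y + 1)).filter (fun t : ℕ × ℕ × ℕ => ((2 ^ N * q ^ v : ℕ) : ℤ) * (t.1 : ℤ) + (1 : ℤ) * (((1 : ℕ) : ℤ) * (t.2.1 : ℤ)) = (t.2.2 : ℤ))) : ℝ) :=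
  fun N M y _ _ hq hq2 hv => tailPairsA_A hq hq2 hv N M y

/-- Position `B` of `FA`: `#FA · cellMass FA B q v` is at most the number of friable `(n₁, n₂, n₃)`,
`n₁ ≤ 2X/q^v`, `n₂ ≤ 2M`, `n₃ ≤ 4X`, with `q^v n₁ + 2^N n₂ = n₃` (`(m, b) ↦ (b/q^v, m, 2^N m + b)`). [folklore] -/
theorem tailPairsA_B {q v : ℕ} (hq : q.Prime) (hv : 1 ≤ v) (N M y : ℕ) :
    ((FAfam N M y).card : ℝ) * cellMass (FAfam N M y) Pos.B q v ≤
      (#((Nat.smoothNumbersUpTo (2 * (2 ^ N * M) / q ^ v) (y + 1) ×ˢ Nat.smoothNumbersUpTo (2 * M) (y + 1) ×ˢ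
            Nat.smoothNumbersUpTo (4 * (2 ^ N * M)) (y + 1)).filter
          (fun t : ℕ × ℕ × ℕ => ((q ^ v : ℕ) : ℤ) * (t.1 : ℤ) + (1 : ℤ) * (((2 ^ N : ℕ) : ℤ) * (t.2.1 : ℤ)) =
            (t.2.2 : ℤ))) : ℝ) := by
  rw [familyCellA_B hq hv]
  refine Nat.cast_le.2 (Finset.card_le_card_of_injOn (fun p : ℕ × ℕ => (p.2 / q ^ v, p.1, 2 ^ N * p.1 + p.2))
    (fun p hp => ?_) (fun p hp p' hp' h => ?_))
  · rw [Finset.coe_filter] at hp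
    obtain ⟨hpP, hfac⟩ := hp
    obtain ⟨hm2, hms, hb2, hbs, hcs⟩ := mem_pairsA hpP
    have hdvd : q ^ v ∣ p.2 := pow_dvd_of_factorization_eq hfac
    have e : q ^ v * (p.2 / q ^ v) + 2 ^ N * p.1 = 2 ^ N * p.1 + p.2 := by rw [Nat.mul_div_cancel' hdvd, add_comm]
    refine Finset.mem_coe.2 (Finset.mem_filter.2 ⟨Finset.mem_product.2 ⟨div_mem_smoothNumbersUpTo hbs hb2 hdvd,
      Finset.mem_product.2 ⟨mem_smoothNumbersUpTo_of_le hms hm2, mem_smoothNumbersUpTo_of_le hcs ?_⟩⟩, ?_⟩)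
    · calc 2 ^ N * p.1 + p.2 ≤ 2 ^ N * (2 * M) + 2 * (2 ^ N * M) := Nat.add_le_add (Nat.mul_le_mul_left _ hm2) hb2
        _ = 4 * (2 ^ N * M) := by ring
    · dsimp only
      rw [one_mul, ← Nat.cast_mul, ← Nat.cast_mul, ← Nat.cast_add, e]
  · simp only [Prod.mk.injEq] at h
    obtain ⟨-, h2, h3⟩ := h
    rw [h2] at h3
    exact Prod.ext h2 (Nat.add_left_cancel h3)

/-- Position `C` of `FA`: `#FA · cellMass FA C q v` is at most the number of friable `(n₁, n₂, n₃)`,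
`n₁ ≤ 4X/q^v`, `n₂ ≤ 2M`, `n₃ ≤ 2X`, with `q^v n₁ − 2^N n₂ = n₃` (`(m, b) ↦ (c/q^v, m, b)`, `c = 2^N m + b`). [folklore] -/
theorem tailPairsA_C {q v : ℕ} (hq : q.Prime) (hv : 1 ≤ v) (N M y : ℕ) :
    ((FAfam N M y).card : ℝ) * cellMass (FAfam N M y) Pos.C q v ≤
      (#((Nat.smoothNumbersUpTo (4 * (2 ^ N * M) / q ^ v) (y + 1) ×ˢ Nat.smoothNumbersUpTo (2 * M) (y + 1) ×ˢ
            Nat.smoothNumbersUpTo (2 * (2 ^ N * M)) (y + 1)).filter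
          (fun t : ℕ × ℕ × ℕ => ((q ^ v : ℕ) : ℤ) * (t.1 : ℤ) + (-1 : ℤ) * (((2 ^ N : ℕ) : ℤ) * (t.2.1 : ℤ)) =
            (t.2.2 : ℤ))) : ℝ) := by
  rw [familyCellA_C hq hv]
  refine Nat.cast_le.2 (Finset.card_le_card_of_injOn (fun p : ℕ × ℕ => ((2 ^ N * p.1 + p.2) / q ^ v, p.1, p.2))
    (fun p hp => ?_) (fun p hp p' hp' h => ?_))
  · rw [Finset.coe_filter] at hp
    obtain ⟨hpP, hfac⟩ := hp
    obtain ⟨hm2, hms, hb2, hbs, hcs⟩ := mem_pairsA hpP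
    have hdvd : q ^ v ∣ 2 ^ N * p.1 + p.2 := pow_dvd_of_factorization_eq hfac
    have hc4 : 2 ^ N * p.1 + p.2 ≤ 4 * (2 ^ N * M) :=
      calc 2 ^ N * p.1 + p.2 ≤ 2 ^ N * (2 * M) + 2 * (2 ^ N * M) := Nat.add_le_add (Nat.mul_le_mul_left _ hm2) hb2
        _ = 4 * (2 ^ N * M) := by ring
    refine Finset.mem_coe.2 (Finset.mem_filter.2 ⟨Finset.mem_product.2 ⟨div_mem_smoothNumbersUpTo hcs hc4 hdvd,
      Finset.mem_product.2 ⟨mem_smoothNumbersUpTo_of_le hms hm2, mem_smoothNumbersUpTo_of_le hbs hb2⟩⟩, ?_⟩)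
    dsimp only
    rw [← Nat.cast_mul, Nat.mul_div_cancel' hdvd, Nat.cast_add, Nat.cast_mul]
    ring
  · simp only [Prod.mk.injEq] at h
    exact Prod.ext h.2.1 h.2.2

/-! ### The family `FC` -/

/-- Position `A` of `FC`: `#FC · cellMass FC A q v` is at most the number of friable `(n₁, n₂, n₃)`,
`n₁ ≤ 4M`, `n₂ ≤ 2X/q^v`, `n₃ ≤ 4X`, with `2^N n₁ − q^v n₂ = n₃` (`(m, a) ↦ (m, a/q^v, b)`, `b = 2^N m − a`). [folklore] -/
theorem tailPairsC_A {q v : ℕ} (hq : q.Prime) (hv : 1 ≤ v) (N M y : ℕ) :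
    ((FCfam N M y).card : ℝ) * cellMass (FCfam N M y) Pos.A q v ≤
      (#((Nat.smoothNumbersUpTo (4 * M) (y + 1) ×ˢ Nat.smoothNumbersUpTo (2 * (2 ^ N * M) / q ^ v) (y + 1) ×ˢ
            Nat.smoothNumbersUpTo (4 * (2 ^ N * M)) (y + 1)).filter
          (fun t : ℕ × ℕ × ℕ => ((2 ^ N : ℕ) : ℤ) * (t.1 : ℤ) + (-1 : ℤ) * (((q ^ v : ℕ) : ℤ) * (t.2.1 : ℤ)) =
            (t.2.2 : ℤ))) : ℝ) := by
  rw [familyCellC_A hq hv]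
  refine Nat.cast_le.2 (Finset.card_le_card_of_injOn (fun p : ℕ × ℕ => (p.1, p.2 / q ^ v, 2 ^ N * p.1 - p.2))
    (fun p hp => ?_) (fun p hp p' hp' h => ?_))
  · rw [Finset.coe_filter] at hp
    obtain ⟨hpP, hfac⟩ := hp
    obtain ⟨hm4, hms, ha2, has, hbs, hb4, hsum⟩ := mem_pairsC hpP
    have hdvd : q ^ v ∣ p.2 := pow_dvd_of_factorization_eq hfac
    refine Finset.mem_coe.2 (Finset.mem_filter.2 ⟨Finset.mem_product.2 ⟨mem_smoothNumbersUpTo_of_le hms hm4,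
      Finset.mem_product.2 ⟨div_mem_smoothNumbersUpTo has ha2 hdvd, mem_smoothNumbersUpTo_of_le hbs hb4⟩⟩, ?_⟩)
    dsimp only
    have h1 : ((p.2 : ℕ) : ℤ) + ((2 ^ N * p.1 - p.2 : ℕ) : ℤ) = ((2 ^ N * p.1 : ℕ) : ℤ) := by exact_mod_cast hsum
    rw [← Nat.cast_mul (q ^ v), Nat.mul_div_cancel' hdvd, ← Nat.cast_mul]
    linarith
  · simp only [Prod.mk.injEq] at h
    obtain ⟨h1, -, h3⟩ := h
    have hs := (mem_pairsC (Finset.mem_coe.1 (Finset.mem_of_mem_filter p hp))).2.2.2.2.2.2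
    have hs' := (mem_pairsC (Finset.mem_coe.1 (Finset.mem_of_mem_filter p' hp'))).2.2.2.2.2.2
    rw [h3, h1] at hs
    exact Prod.ext h1 (Nat.add_right_cancel (hs.trans hs'.symm))

/-- Position `B` of `FC`: `#FC · cellMass FC B q v` is at most the number of friable `(n₁, n₂, n₃)`,
`n₁ ≤ 4M`, `n₂ ≤ 4X/q^v`, `n₃ ≤ 2X`, with `2^N n₁ − q^v n₂ = n₃` (`(m, a) ↦ (m, b/q^v, a)`). [folklore] -/
theorem tailPairsC_B {q v : ℕ} (hq : q.Prime) (hv : 1 ≤ v) (N M y : ℕ) :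
    ((FCfam N M y).card : ℝ) * cellMass (FCfam N M y) Pos.B q v ≤
      (#((Nat.smoothNumbersUpTo (4 * M) (y + 1) ×ˢ Nat.smoothNumbersUpTo (4 * (2 ^ N * M) / q ^ v) (y + 1) ×ˢ
            Nat.smoothNumbersUpTo (2 * (2 ^ N * M)) (y + 1)).filter
          (fun t : ℕ × ℕ × ℕ => ((2 ^ N : ℕ) : ℤ) * (t.1 : ℤ) + (-1 : ℤ) * (((q ^ v : ℕ) : ℤ) * (t.2.1 : ℤ)) =
            (t.2.2 : ℤ))) : ℝ) := by
  rw [familyCellC_B hq hv]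
  refine Nat.cast_le.2 (Finset.card_le_card_of_injOn (fun p : ℕ × ℕ => (p.1, (2 ^ N * p.1 - p.2) / q ^ v, p.2))
    (fun p hp => ?_) (fun p hp p' hp' h => ?_))
  · rw [Finset.coe_filter] at hp
    obtain ⟨hpP, hfac⟩ := hp
    obtain ⟨hm4, hms, ha2, has, hbs, hb4, hsum⟩ := mem_pairsC hpP
    have hdvd : q ^ v ∣ 2 ^ N * p.1 - p.2 := pow_dvd_of_factorization_eq hfac
    refine Finset.mem_coe.2 (Finset.mem_filter.2 ⟨Finset.mem_product.2 ⟨mem_smoothNumbersUpTo_of_le hms hm4,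
      Finset.mem_product.2 ⟨div_mem_smoothNumbersUpTo hbs hb4 hdvd, mem_smoothNumbersUpTo_of_le has ha2⟩⟩, ?_⟩)
    dsimp only
    have h1 : ((p.2 : ℕ) : ℤ) + ((2 ^ N * p.1 - p.2 : ℕ) : ℤ) = ((2 ^ N * p.1 : ℕ) : ℤ) := by exact_mod_cast hsum
    rw [← Nat.cast_mul (q ^ v), Nat.mul_div_cancel' hdvd, ← Nat.cast_mul]
    linarith
  · simp only [Prod.mk.injEq] at h
    exact Prod.ext h.1 h.2.2

/-- Position `C` of `FC`: `#FC · cellMass FC C q v` is at most the number of friable `(n₁, n₂, n₃)`,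
`n₁ ≤ 4M/q^v`, `n₂ ≤ 2X`, `n₃ ≤ 4X`, with `2^N q^v n₁ − n₂ = n₃` (`(m, a) ↦ (m/q^v, a, b)`; `q` odd). [folklore] -/
theorem tailPairsC_C {q v : ℕ} (hq : q.Prime) (hq2 : q ≠ 2) (hv : 1 ≤ v) (N M y : ℕ) :
    ((FCfam N M y).card : ℝ) * cellMass (FCfam N M y) Pos.C q v ≤
      (#((Nat.smoothNumbersUpTo (4 * M / q ^ v) (y + 1) ×ˢ Nat.smoothNumbersUpTo (2 * (2 ^ N * M)) (y + 1) ×ˢ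
            Nat.smoothNumbersUpTo (4 * (2 ^ N * M)) (y + 1)).filter
          (fun t : ℕ × ℕ × ℕ => ((2 ^ N * q ^ v : ℕ) : ℤ) * (t.1 : ℤ) + (-1 : ℤ) * (((1 : ℕ) : ℤ) * (t.2.1 : ℤ)) =
            (t.2.2 : ℤ))) : ℝ) := by
  rw [familyCellC_C hq hv]
  refine Nat.cast_le.2 (Finset.card_le_card_of_injOn (fun p : ℕ × ℕ => (p.1 / q ^ v, p.2, 2 ^ N * p.1 - p.2))
    (fun p hp => ?_) (fun p hp p' hp' h => ?_))
  · rw [Finset.coe_filter] at hp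
    obtain ⟨hpP, hfac⟩ := hp
    obtain ⟨hm4, hms, ha2, has, hbs, hb4, hsum⟩ := mem_pairsC hpP
    rw [factorization_two_pow_mul hq2] at hfac
    have hdvd : q ^ v ∣ p.1 := pow_dvd_of_factorization_eq hfac
    have e : 2 ^ N * q ^ v * (p.1 / q ^ v) = 2 ^ N * p.1 := by rw [mul_assoc, Nat.mul_div_cancel' hdvd]
    refine Finset.mem_coe.2 (Finset.mem_filter.2 ⟨Finset.mem_product.2 ⟨div_mem_smoothNumbersUpTo hms hm4 hdvd,
      Finset.mem_product.2 ⟨mem_smoothNumbersUpTo_of_le has ha2, mem_smoothNumbersUpTo_of_le hbs hb4⟩⟩, ?_⟩)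
    dsimp only
    have h1 : ((p.2 : ℕ) : ℤ) + ((2 ^ N * p.1 - p.2 : ℕ) : ℤ) = ((2 ^ N * p.1 : ℕ) : ℤ) := by exact_mod_cast hsum
    rw [Nat.cast_one, one_mul, ← Nat.cast_mul, e]
    linarith
  · simp only [Prod.mk.injEq] at h
    obtain ⟨-, h2, h3⟩ := h
    have hs := (mem_pairsC (Finset.mem_coe.1 (Finset.mem_of_mem_filter p hp))).2.2.2.2.2.2
    have hs' := (mem_pairsC (Finset.mem_coe.1 (Finset.mem_of_mem_filter p' hp'))).2.2.2.2.2.2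
    rw [h3, h2] at hs
    exact Prod.ext (Nat.eq_of_mul_eq_mul_left (Nat.two_pow_pos N) (hs.symm.trans hs')) h2

end Summit.ABC.ABC.Theorems.TameLocalReceptacle

end
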